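import Literature.MathematicalPhysics.QuantumFieldTheory.OverlapQCDOS

/-!
# Route `OverlapPositivityTransfer` — typed decomposition of the crux `OverlapContinuumLimit`
# (item stmt-QuantumFields-17584): the assembly theorem

BC2-redirect of the RESTATED deciding crux `OverlapContinuumLimit`
(`∀ N_f ∈ {2,3}, OverlapChiralGapPackage N_f → OverlapChiralQCDOf N_f`: continuum limit AND Osterwalder–Schrader
axioms AND non-triviality AND both mass gaps of admissible-overlap lattice QCD, given the chiral lattice-gap
package) into three typed pieces, and the PROOF that they imply it:

* `A` = `OverlapConvergentClosure` — the UV/IR engine of the positive overlap world, OS-closed MODULO reflection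
  positivity and rotations: from the package, one regularisation (mass scaling, gap closing at zero) and, for
  every positive mass tuple, species renormalisations `z, shift` and a labelled Schwinger family `S` which IS the
  limit of the renormalised overlap lattice Schwinger functions on off-diagonal real tensors, is normalised,
  hermitian, of linear growth (E0'), translation invariant, symmetric (E3), clustering (E4), carries explicit
  non-triviality witnesses (glue, flavour-changing pseudoscalars) and a `κ₃ ≠ 0` witness, and has the species
  mass gap `S.HasMassGap Δ` together with the overlap-lattice gap at the same `Δ > 0`;
* `B` = `OverlapLimitPositivity` — E2 for every continuum limit of admissible-overlap lattice QCD along an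
  asymptotically scaling scheme (bare overlap masses eventually in `(0,2)`, a uniform overlap-lattice gap,
  normalised limit): `S.IsReflectionPositive` (exact lattice reflection positivity fails for the admissibility
  cut — Creutz 2004 — and is open for interacting overlap quarks — Kikukawa–Usui 2010);
* `C` = `OverlapRotationRestoration` — E1-rotations for every such limit (proper-rotation invariance on `⁰𝒮`).

`overlapContinuumLimit_of_subs : A → B → C → OverlapContinuumLimit` — unpack `A` at `(N_f, m)`, apply `B` and
`C` to the scheme `reg.scheme m z shift` and the limit `S`, assemble `T : OSData := ⟨S, E0, E0-herm, E0', ⟨transl,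
rot⟩, E2, E3, E4⟩`; the species clauses of `OverlapChiralQCDOf` are the witnesses of `A` read through
`T.schwinger = S` (definitional).  Pure logic over the Literature vocabulary (`OverlapQCDOS`, `OSData`,
`OSAxiomsSchwinger`); the statement is spelled STRUCTURALLY (no import of the Theses file), so that the gate can
link it as `theorem OverlapContinuumLimitGlueBy_holds : OverlapConvergentClosure → OverlapLimitPositivity →
OverlapRotationRestoration → OverlapContinuumLimit := overlapContinuumLimit_of_subs` (δ-unfolding; certified in the
strategist's `LinkTest.lean`, rc 0).  Strategist seat `cstrat-stmt-QuantumFields-17584-r1`, 2026-08-17.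

References: K. Osterwalder, R. Schrader, CMP 31 (1973) 83 and 42 (1975) 281 (axioms E0–E4, E0');
A. Jaffe, E. Witten, *Quantum Yang–Mills theory* (2000), §§1, 4, 5; M. Creutz, *Positivity and topology in
lattice gauge theory*, PRD 70 (2004) 091501 (hep-lat/0409017); Y. Kikukawa, K. Usui, *Reflection positivity of
free overlap fermions*, PRD 82 (2010) 114503 (arXiv:1005.3751).
-/

namespace Summit.QuantumFields.QCD.Theorems

open scoped BigOperators Topology
open Filter
open Literature.MathematicalPhysics.QuantumFieldTheory Literature.MathematicalPhysics.QuantumLattice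
  Literature.MathematicalPhysics.AQFT

/-- **Assembly of the typed decomposition of `OverlapPositivityTransfer.OverlapContinuumLimit`**
(stmt-QuantumFields-17584): `OverlapConvergentClosure → OverlapLimitPositivity → OverlapRotationRestoration →
OverlapContinuumLimit`, each spelled structurally (the four route decls are these terms verbatim). Proof: for
`N_f ∈ {2,3}` and the chiral gap package, piece A gives the regularisation `reg` (mass scaling, gap closing at
zero) and, per positive mass tuple `m`, `z, shift, S` with asymptotic scaling, the mass window, convergence, E0,
E0', translations, E3, E4, the witnesses and both gaps at `Δ > 0`; piece B gives E2 and piece C the rotation half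
of E1 for `(reg.scheme m z shift, S)`; `T := ⟨S, …⟩ : OSData` then satisfies `IsOverlapQCDAlong`, and its
non-triviality / non-Gaussianity / dynamical-flavour clauses are A's witnesses since `T.schwinger = S`
definitionally. [folklore] -/
theorem overlapContinuumLimit_of_subs
    (hA : (open Literature.MathematicalPhysics.QuantumFieldTheory Literature.MathematicalPhysics.QuantumLattice Literature.MathematicalPhysics.AQFT in ∀ Nf : ℕ, Nf = 2 ∨ Nf = 3 → OverlapChiralGapPackage Nf → ∃ reg : QCDRegularisation Nf, reg.HasMassScaling ∧ reg.OverlapGapClosesAtZero ∧ ∀ m : Fin Nf → ℝ, (∀ f, 0 < m f) → ∃ (z shift : QCDField Nf → ℕ → ℝ) (S : LabelledSchwingerFamily (QCDField Nf) (EuclideanSpace ℝ (Fin 4))), (reg.scheme m z shift).HasAsymptoticScaling ∧ (∀ fl : Fin Nf, ∀ᶠ k in Filter.atTop, 0 < (reg.scheme m z shift).mq fl k ∧ (reg.scheme m z shift).mq fl k < 2) ∧ (∀ n : ℕ, n ≠ 0 → ∀ (σ : Fin n → QCDField Nf) (f : Fin n → SchwartzMap (EuclideanSpace ℝ (Fin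 4)) ℝ) (F : SchwartzMap (Fin n → EuclideanSpace ℝ (Fin 4)) ℂ), IsTensorOf F (fun i => ofRealTest (f i)) → IsOffDiagonal F → Filter.Tendsto (fun k : ℕ => overlapLatticeSchwinger (reg.scheme m z shift) k n σ f) Filter.atTop (nhds (S n σ F))) ∧ S.IsNormalized ∧ S.IsHermitian ∧ S.HasLinearGrowth ∧ (∀ (n : ℕ) (σ : Fin n → QCDField Nf) (a : EuclideanSpace ℝ (Fin 4)) (F : SchwartzMap (Fin n → EuclideanSpace ℝ (Fin 4)) ℂ), IsOffDiagonal F → S n σ (translateMulti a F) = S n σ F) ∧ S.IsSymmetric ∧ S.HasClusterProperty ∧ (∀ s : QCDField Nf, (s = QCDField.glue ∨ ∃ f g : Fin Nf, f ≠ g ∧ s = QCDField.pseudoRe f g) → ∃ (F G : SchwartzMap (Fin 1 → EuclideanSpace ℝ (Fin 4)) ℂ) (H : SchwartzMap (Fin (1 + 1) → EuclideanSpace ℝ (Fin 4)) ℂ), IsTimeOrdered F ∧ IsTimeOrdered G ∧ IsAppendTensorOf H (osAdjoint F) G ∧ S (1 + 1) (fun _ => s) H ≠ S 1 (fun _ =>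 s) (osAdjoint F) * S 1 (fun _ => s) G) ∧ (∃ (f g h : SchwartzMap (EuclideanSpace ℝ (Fin 4)) ℂ) (Ffgh : SchwartzMap (Fin 3 → EuclideanSpace ℝ (Fin 4)) ℂ) (Fgh Ffh Ffg : SchwartzMap (Fin 2 → EuclideanSpace ℝ (Fin 4)) ℂ) (Ff Fg Fh : SchwartzMap (Fin 1 → EuclideanSpace ℝ (Fin 4)) ℂ), IsTensorOf Ffgh ![f, g, h] ∧ IsOffDiagonal Ffgh ∧ IsTensorOf Fgh ![g, h] ∧ IsTensorOf Ffh ![f, h] ∧ IsTensorOf Ffg ![f, g] ∧ IsTensorOf Ff ![f] ∧ IsTensorOf Fg ![g] ∧ IsTensorOf Fh ![h] ∧ S 3 (fun _ => QCDField.glue) Ffgh - S 1 (fun _ => QCDField.glue) Ff * S 2 (fun _ => QCDField.glue) Fgh - S 1 (fun _ => QCDField.glue) Fg * S 2 (fun _ => QCDField.glue) Ffh - S 1 (fun _ => QCDField.glue) Fh * S 2 (fun _ => QCDField.glue) Ffg + 2 * (S 1 (fun _ => QCDField.glue) Ff * S 1 (fun _ => QCDField.glue) Fg * S 1 (fun _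 => QCDField.glue) Fh) ≠ 0) ∧ ∃ Δ > 0, S.HasMassGap Δ ∧ (reg.scheme m z shift).OverlapHasLatticeMassGap Δ))
    (hB : (open Literature.MathematicalPhysics.QuantumFieldTheory Literature.MathematicalPhysics.QuantumLattice Literature.MathematicalPhysics.AQFT in ∀ Nf : ℕ, Nf = 2 ∨ Nf = 3 → ∀ (sch : QCDScheme Nf) (S : LabelledSchwingerFamily (QCDField Nf) (EuclideanSpace ℝ (Fin 4))), sch.HasAsymptoticScaling → (∀ fl : Fin Nf, ∀ᶠ k in Filter.atTop, 0 < sch.mq fl k ∧ sch.mq fl k < 2) → (∃ Δ : ℝ, 0 < Δ ∧ sch.OverlapHasLatticeMassGap Δ) → S.IsNormalized → (∀ n : ℕ, n ≠ 0 → ∀ (σ : Fin n → QCDField Nf) (f : Fin n → SchwartzMap (EuclideanSpace ℝ (Fin 4)) ℝ) (F : SchwartzMap (Fin n → EuclideanSpace ℝ (Fin 4)) ℂ), IsTensorOf F (fun i => ofRealTest (f i)) → IsOffDiagonal F → Filter.Tendsto (fun k : ℕ => overlapLatticeSchwinger sch k n σ f) Filter.atTop (nhds (S n σ F))) → S.I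sReflectionPositive))
    (hC : (open Literature.MathematicalPhysics.QuantumFieldTheory Literature.MathematicalPhysics.QuantumLattice Literature.MathematicalPhysics.AQFT in ∀ Nf : ℕ, Nf = 2 ∨ Nf = 3 → ∀ (sch : QCDScheme Nf) (S : LabelledSchwingerFamily (QCDField Nf) (EuclideanSpace ℝ (Fin 4))), sch.HasAsymptoticScaling → (∀ fl : Fin Nf, ∀ᶠ k in Filter.atTop, 0 < sch.mq fl k ∧ sch.mq fl k < 2) → (∃ Δ : ℝ, 0 < Δ ∧ sch.OverlapHasLatticeMassGap Δ) → (∀ n : ℕ, n ≠ 0 → ∀ (σ : Fin n → QCDField Nf) (f : Fin n → SchwartzMap (EuclideanSpace ℝ (Fin 4)) ℝ) (F : SchwartzMap (Fin n → EuclideanSpace ℝ (Fin 4)) ℂ), IsTensorOf F (fun i => ofRealTest (f i)) → IsOffDiagonal F → Filter.Tendsto (fun k : ℕ => overlapLatticeSchwinger sch k n σ f) Filter.atTop (nhds (S n σ F))) → ∀ (n : ℕ) (σ : Fin n → QCDField Nf) (R : EuclideanSpace ℝ (Fin 4) ≃ₗᵢ[ℝ] EuclideanSpace ℝ (Fin 4)),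 LinearMap.det (R.toLinearEquiv : EuclideanSpace ℝ (Fin 4) →ₗ[ℝ] EuclideanSpace ℝ (Fin 4)) = 1 → ∀ F : SchwartzMap (Fin n → EuclideanSpace ℝ (Fin 4)) ℂ, IsOffDiagonal F → S n σ (linActMulti R F) = S n σ F)) :
    (open Literature.MathematicalPhysics.QuantumFieldTheory in ∀ Nf : ℕ, Nf = 2 ∨ Nf = 3 → OverlapChiralGapPackage Nf → OverlapChiralQCDOf Nf) := by
  intro Nf hNf hpkg
  obtain ⟨reg, hMS, hχ, hbody⟩ := hA Nf hNf hpkg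
  refine ⟨reg, hMS, hχ, fun m hm => ?_⟩
  obtain ⟨z, shift, S, hAS, hwin, hconv, hnorm, hherm, hgrowth, htransl, hsymm, hclus, hNT, hNG,
    Δ, hΔ, hgapS, hgapL⟩ := hbody m hm
  have hRP := hB Nf hNf (reg.scheme m z shift) S hAS hwin ⟨Δ, hΔ, hgapL⟩ hnorm hconv
  have hrot := hC Nf hNf (reg.scheme m z shift) S hAS hwin ⟨Δ, hΔ, hgapL⟩ hconv
  let T : OSData (QCDField Nf) 4 := ⟨S, hnorm, hherm, hgrowth, ⟨htransl, hrot⟩, hRP, hsymm, hclus⟩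
  refine ⟨z, shift, T, ⟨hAS, hwin, hconv⟩, ?_, hNG, ?_, Δ, hΔ, hgapS, hgapL⟩
  · exact hNT _ (Or.inl rfl)
  · intro f g hfg
    exact hNT _ (Or.inr ⟨f, g, hfg, rfl⟩)

end Summit.QuantumFields.QCD.Theorems
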